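import Literature.Geometry.Lorentzian.EinsteinTensorNaturality
import Literature.Geometry.Lorentzian.KillingHorizonShadowAlong
import Literature.Geometry.Lorentzian.MetricValCongr
import HarnessLib

/-!
# Killing fields on an open set pull back under local isometries; isometries of `g` transport them

Local companion of `IsKillingField.comap_mpullback` (`EinsteinTensorNaturality.lean`, GLOBAL Killing
fields): the literature on stationary black holes manipulates Killing fields that are only defined on
an open subset — a neighbourhood of the event horizon (the horizon Killing field `K₀ + Ω K₁` "defined
near `𝓔⁺`", Chruściel–Costa 2008, Thm. 4.14 and §4.1), or the domain of outer communications — and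
transports them with the one-parameter group of isometries `φₜ[X]` generated by the stationary Killing
field (`φₜ[X]_* Y`, loc. cit. §2.2 and §4.1).  In the tree such a field is
`PseudoRiemannianMetric.IsKillingFieldOn K U` (`KillingHorizonShadowAlong.lean`: `K` is `C^n` on `U`
and satisfies the Killing equation at the points of `U`).  We prove, for a smooth metric `g` on `M`
and a smooth equidimensional immersion `Φ : N → M` (the setting of `ConnectionNaturality.lean`):

* `IsKillingFieldOn.comap_mpullback` — if `X` is a Killing field of `g` on an OPEN set `𝒪 ⊆ M`, then
  `Φ^* X = (dΦ)⁻¹ (X ∘ Φ)` (`VectorField.mpullback`) is a Killing field of `Φ^* g` on `Φ ⁻¹' 𝒪`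
  (O'Neill 1983, Ch. 9, Prop. 9.25 with Ch. 3, Prop. 3.59: `∇^{Φ^*g}_v Φ^*X = (dΦ)⁻¹ ∇^g_{dΦ v} X`);
* `injective_mfderiv_of_val_mfderiv_eq`, `val_comap_eq_of_val_mfderiv_eq`,
  `leviCivita_comap_eq_of_val_mfderiv_eq` — for a smooth self-map `Φ : M → M` which is an
  infinitesimal isometry of `g` (`g_{Φ x}(dΦ v, dΦ w) = gₓ(v, w)`, the form in which
  `StationaryAFBlackHole.exists_stationary_flow` delivers the stationary isometries): `dΦ` is injective,
  `Φ^* g = g` value-wise, hence `∇^{Φ^* g} = ∇^g` (`leviCivita_congr_of_val_eq`);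
* `leviCivita_mpullback_apply_of_val_mfderiv_eq` — **isometries preserve the Levi-Civita connection**,
  in the transport form `∇^g_v (Φ^*X)(x) = (dΦₓ)⁻¹ (∇^g_{dΦₓ v} X)(Φ x)` (O'Neill 1983, Ch. 3,
  Prop. 3.59 / Cor. 3.61);
* `IsKillingFieldOn.mpullback_of_val_mfderiv_eq` — **an isometry of `g` carries a Killing field of
  `g` on `𝒪` to a Killing field of `g` on `Φ ⁻¹' 𝒪`** (O'Neill 1983, Ch. 9, p. 250: `dΦ` maps Killing
  fields to Killing fields; this is the operation `Y ↦ φₜ[X]_* Y` of Chruściel–Costa 2008, §2.2, for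
  `Φ = φ₋ₜ`).

Everything is proved; no definitions, no named facts.

## References

* B. O'Neill, *Semi-Riemannian geometry with applications to relativity*, Academic Press 1983, Ch. 3,
  Prop. 3.59 and Cor. 3.60–3.61 (pp. 90–91); Ch. 9, Def. 9.22–Prop. 9.25 (pp. 250–251).
  (key `ONeill1983`)
* P. T. Chruściel, J. L. Costa, *On uniqueness of stationary vacuum black holes*, Astérisque 321
  (2008) 195–265 = arXiv:0806.0016, §2.2 (`φₜ[X]`), §4.1, Thm. 4.14. (key `ChruscielCosta2008`)
-/

noncomputable section

open Bundle Set Function Filter FiberBundle VectorField ContinuousLinearMap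
open scoped Manifold ContDiff Topology

namespace Literature.Geometry.Lorentzian

namespace PseudoRiemannianMetric

/-! ### Killing fields on an open set pull back under equidimensional immersions -/

section Comap

variable {E : Type*} [NormedAddCommGroup E] [NormedSpace ℝ E] {H : Type*} [TopologicalSpace H]
  {I : ModelWithCorners ℝ E H} {M : Type*} [TopologicalSpace M] [ChartedSpace H M]
  [IsManifold I ∞ M]
  {E' : Type*} [NormedAddCommGroup E'] [NormedSpace ℝ E'] {H' : Type*} [TopologicalSpace H']
  {I' : ModelWithCorners ℝ E' H'} {N : Type*} [TopologicalSpace N] [ChartedSpace H' N]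
  [IsManifold I' ∞ N]
  [FiniteDimensional ℝ E] [FiniteDimensional ℝ E'] [CompleteSpace E] [CompleteSpace E']
  (g : PseudoRiemannianMetric I ∞ E (TangentSpace I : M → Type _))
  {Φ : N → M} (hpb : contMDiff_pullbackBilin I M I' N ∞) (hΦ : ContMDiff I' I (∞ + 1) Φ)
  (hΦ' : ∀ u, Function.Injective (mfderiv I' I Φ u))
  (hdim : Module.finrank ℝ E' = Module.finrank ℝ E)

omit [CompleteSpace E] in
include hΦ' in
/-- **Killing fields on an open set pull back to Killing fields under equidimensional immersions.**
If `X` is a Killing field of the smooth metric `g` on the open set `𝒪 ⊆ M` (`IsKillingFieldOn`: smooth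
on `𝒪`, Killing equation at the points of `𝒪`) and `Φ : N → M` is a smooth immersion between manifolds
of the same dimension, then `Φ^* X = (dΦ)⁻¹ (X ∘ Φ)` is a Killing field of `Φ^* g` on `Φ ⁻¹' 𝒪`:
smooth there by `ContMDiffOn.mpullback_vectorField_preimage`, and the Killing equation at `u ∈ Φ⁻¹' 𝒪`
is that of `X` at `Φ u` read through `dΦ_u` (`val_leviCivita_mpullback_add`). O'Neill 1983, Ch. 9,
Prop. 9.25 with Ch. 3, Prop. 3.59 (local form of `IsKillingField.comap_mpullback`).
[cite: ONeill1983, Ch. 9, Prop. 9.25] -/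
theorem IsKillingFieldOn.comap_mpullback [g.HasLeviCivita]
    [(g.comap hpb Φ hΦ hΦ' hdim).HasLeviCivita] {X : Π x : M, TangentSpace I x} {𝒪 : Set M}
    (h𝒪 : IsOpen 𝒪) (hX : g.IsKillingFieldOn X 𝒪) :
    (g.comap hpb Φ hΦ hΦ' hdim).IsKillingFieldOn (mpullback I' I Φ X) (Φ ⁻¹' 𝒪) := by
  have hinv : ∀ u, (mfderiv I' I Φ u).IsInvertible := fun u ↦
    isInvertible_mfderiv_of_injective (Φ := Φ) hdim (hΦ' u)
  refine ⟨hX.contMDiffOn.mpullback_vectorField_preimage hΦ (fun u _ ↦ hinv u) le_rfl,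
    fun u hu Y₀ Z₀ ↦ ?_⟩
  have hXd : MDiffAt (T% X) (Φ u) := hX.mdifferentiableAt h𝒪 hu
  rw [g.val_leviCivita_mpullback_add hpb hΦ hΦ' hdim hXd Y₀ Z₀]
  exact hX.val_leviCivita_add hu _ _

end Comap

/-! ### Infinitesimal isometries of `g`: `Φ^* g = g`, `∇^{Φ^*g} = ∇^g`, transport of Killing fields -/

section Isometry

variable {E : Type*} [NormedAddCommGroup E] [NormedSpace ℝ E] {H : Type*} [TopologicalSpace H]
  {I : ModelWithCorners ℝ E H} {M : Type*} [TopologicalSpace M] [ChartedSpace H M]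
  [IsManifold I ∞ M]
  (g : PseudoRiemannianMetric I ∞ E (TangentSpace I : M → Type _))
  {Φ : M → M}

/-- **The differential of an infinitesimal isometry is injective**: if
`g_{Φ x}(dΦₓ v, dΦₓ w) = gₓ(v, w)` for all `v, w`, then `dΦₓ v = 0` forces `gₓ(v, ·) = 0`, i.e. `v = 0`
by nondegeneracy. O'Neill 1983, Ch. 3, p. 58 (a linear isometry of nondegenerate scalar product spaces
is injective). [cite: ONeill1983, Ch. 3, p. 58] -/
theorem injective_mfderiv_of_val_mfderiv_eq
    (hiso : ∀ (x : M) (v w : TangentSpace I x),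
      g.val (Φ x) (mfderiv I I Φ x v) (mfderiv I I Φ x w) = g.val x v w) (x : M) :
    Function.Injective (mfderiv I I Φ x) := by
  refine (injective_iff_map_eq_zero _).2 fun v hv ↦ g.nondegenerate x v fun w ↦ ?_
  rw [← hiso x v w, hv, map_zero, zero_apply]

variable [FiniteDimensional ℝ E] [CompleteSpace E]
  (hpb : contMDiff_pullbackBilin I M I M ∞) (hΦ : ContMDiff I I (∞ + 1) Φ)
  (hiso : ∀ (x : M) (v w : TangentSpace I x),
    g.val (Φ x) (mfderiv I I Φ x v) (mfderiv I I Φ x w) = g.val x v w)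

omit [CompleteSpace E] in
include hiso in
/-- **An infinitesimal isometry pulls `g` back to itself**: `(Φ^* g)ₓ = gₓ` for the pullback metric
`g.comap … Φ …` of `Isometry.lean`. O'Neill 1983, Ch. 3, Def. 3.4 (p. 58: `Φ` is an isometry iff
`Φ^* g = g`). [cite: ONeill1983, Ch. 3, Def. 3.4 (p. 58)] -/
theorem val_comap_eq_of_val_mfderiv_eq (x : M) :
    (g.comap hpb Φ hΦ (g.injective_mfderiv_of_val_mfderiv_eq hiso) rfl).val x = g.val x := by
  ext v w
  rw [val_comap, pullbackBilin_apply, hiso]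

omit [CompleteSpace E] in
include hiso in
/-- **Isometries preserve the Levi-Civita connection** (O'Neill 1983, Ch. 3, Prop. 3.59 /
Cor. 3.61): the Levi-Civita connection of `Φ^* g` is that of `g` when `Φ` is an infinitesimal
isometry of `g` — the two metrics have the same values (`val_comap_eq_of_val_mfderiv_eq`,
`leviCivita_congr_of_val_eq`). [cite: ONeill1983, Ch. 3, Prop. 3.59] -/
theorem leviCivita_comap_eq_of_val_mfderiv_eq [g.HasLeviCivita]
    [(g.comap hpb Φ hΦ (g.injective_mfderiv_of_val_mfderiv_eq hiso) rfl).HasLeviCivita] :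
    (g.comap hpb Φ hΦ (g.injective_mfderiv_of_val_mfderiv_eq hiso) rfl).leviCivita =
      g.leviCivita :=
  leviCivita_congr_of_val_eq (g.val_comap_eq_of_val_mfderiv_eq hpb hΦ hiso)

include hpb hΦ hiso in
/-- **Transport of the covariant derivative by an isometry** (O'Neill 1983, Ch. 3, Prop. 3.59,
`dΦ (∇_v W) = ∇_{dΦ v} (dΦ W)` for `Φ`-related fields, read for `W = Φ^* X`): for a smooth
infinitesimal isometry `Φ` of `g` and a vector field `X` differentiable at `Φ x`,
`∇^g_v (Φ^* X)(x) = (dΦₓ)⁻¹ (∇^g_{dΦₓ v} X)(Φ x)`. Proof: `∇^g = ∇^{Φ^* g}`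
(`leviCivita_comap_eq_of_val_mfderiv_eq`) and naturality of the Levi-Civita connection
(`leviCivita_comap_mpullback_apply`). [cite: ONeill1983, Ch. 3, Prop. 3.59] -/
theorem leviCivita_mpullback_apply_of_val_mfderiv_eq [g.HasLeviCivita]
    {X : Π x : M, TangentSpace I x} {x : M} (hX : MDiffAt (T% X) (Φ x)) (v : TangentSpace I x) :
    g.leviCivita (mpullback I I Φ X) x v =
      (mfderiv I I Φ x).inverse (g.leviCivita X (Φ x) (mfderiv I I Φ x v)) := by
  haveI := (g.comap hpb Φ hΦ (g.injective_mfderiv_of_val_mfderiv_eq hiso) rfl).hasLeviCivita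
  have h := g.leviCivita_comap_mpullback_apply hpb hΦ
    (g.injective_mfderiv_of_val_mfderiv_eq hiso) rfl hX v
  rwa [g.leviCivita_comap_eq_of_val_mfderiv_eq hpb hΦ hiso] at h

include hpb hΦ hiso in
/-- **An isometry of `g` carries Killing fields of `g` on `𝒪` to Killing fields of `g` on `Φ ⁻¹' 𝒪`.**
For a smooth infinitesimal isometry `Φ : M → M` of the smooth metric `g` and a Killing field `X` of
`g` on the open set `𝒪`, the field `Φ^* X = (dΦ)⁻¹ (X ∘ Φ)` is a Killing field of `g` on `Φ ⁻¹' 𝒪`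
(`IsKillingFieldOn.comap_mpullback` for `Φ^* g`, and `Φ^* g = g`). With `Φ = φ₋ₜ` a stationary
isometry this is the pushed-forward Killing field `(φₜ)_* X` on `φₜ(𝒪)`. O'Neill 1983, Ch. 9, p. 250
(isometries carry Killing fields to Killing fields) with Ch. 3, Prop. 3.59; Chruściel–Costa 2008,
§2.2 and §4.1 (`φₜ[X]_*`). [cite: ONeill1983, Ch. 9, Prop. 9.25] -/
theorem IsKillingFieldOn.mpullback_of_val_mfderiv_eq [g.HasLeviCivita]
    {X : Π x : M, TangentSpace I x} {𝒪 : Set M} (h𝒪 : IsOpen 𝒪) (hX : g.IsKillingFieldOn X 𝒪) :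
    g.IsKillingFieldOn (mpullback I I Φ X) (Φ ⁻¹' 𝒪) := by
  haveI := (g.comap hpb Φ hΦ (g.injective_mfderiv_of_val_mfderiv_eq hiso) rfl).hasLeviCivita
  have h := IsKillingFieldOn.comap_mpullback g hpb hΦ (g.injective_mfderiv_of_val_mfderiv_eq hiso)
    rfl h𝒪 hX
  refine ⟨h.contMDiffOn, fun x hx Y₀ Z₀ ↦ ?_⟩
  have hK := h.val_leviCivita_add hx Y₀ Z₀
  rwa [g.leviCivita_comap_eq_of_val_mfderiv_eq hpb hΦ hiso,
    g.val_comap_eq_of_val_mfderiv_eq hpb hΦ hiso] at hK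

include hpb hΦ hiso in
/-- Global form: an isometry of `g` carries a (global) Killing field of `g` to a Killing field of
`g`. O'Neill 1983, Ch. 9, p. 250. [cite: ONeill1983, Ch. 9, Prop. 9.25] -/
theorem IsKillingField.mpullback_of_val_mfderiv_eq [g.HasLeviCivita]
    {X : Π x : M, TangentSpace I x} (hX : g.IsKillingField X) :
    g.IsKillingField (mpullback I I Φ X) := by
  rw [← isKillingFieldOn_univ] at hX ⊢
  exact IsKillingFieldOn.mpullback_of_val_mfderiv_eq g hpb hΦ hiso isOpen_univ hX

end Isometry

end PseudoRiemannianMetric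

end Literature.Geometry.Lorentzian

end
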